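import Summits.ResolutionOfSingularities.ResolutionOfSingularities.Theorems.UniversalCellsCampaignW82FrobeniusTwistRungs
import Summits.ResolutionOfSingularities.ResolutionOfSingularities.Theorems.UniversalCellsCampaignW82GeometricallyReduced
import Literature.AlgebraicGeometry.Resolution.BirationalDimensionInequality
import Literature.AlgebraicGeometry.Resolution.AlterationsResolution
import Literature.AlgebraicGeometry.Resolution.SmoothStalksRegular
import Literature.AlgebraicGeometry.Resolution.QuasiExcellentSchemes
import Literature.AlgebraicGeometry.Motives.AbelianVarietyKernelDimension
import Mathlib.AlgebraicGeometry.ZariskisMainTheorem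
import HarnessLib

/-!
# [OURS · L1 W8.2] FOR CURVES, NORMALISING A FROBENIUS TWIST SUFFICES — every smooth proper birational
# model of a twisted curve is FINITE (doors 1 and 2 of slot W8.2; every field of characteristic `p`)

Cell `res-hironaka` (run/shared/lean/pub/res-hironaka/), LADDER-RESOLUTION rung L (RESCUE), slot W8.2 of
plan/RESCUE-SEED.md («PRIME-FIELD / UNIVERSALITY TRANSFER instead of descent»); host route `UniversalCells`, host
item `PrimeFieldToPerfect` (stmt-ResolutionOfSingularities-15233); second door `UniformComplexity.PrimeModelTransfer`
(stmt-8933). Proofs file (Theses-free), written by res-L1-s82-pv-1 (gen 4).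

THE CELL IT FILLS. The residual of slot W8.2 in Frobenius-twist form (`CampaignW82.FrobeniusTwistStepRegularAt p M n`
≅ `PerfectionStepAt M n`, `residual_normalForms_tfae`) asks, for each irreducible geometrically reduced `X₀` over
`K = M(t)`, for SOME exponent `e` and SOME proper birational `π : Y ⟶ X₀^{(p^e)}` with `Y` smooth over `K`. Its
tightness census (L/res-L1-type-o6/W82-TYPED-MAP.md §11) has four refuted strengthenings (T1 `e := 0`, T2 `e`
bounded, T3 «every resolution», all false at grade 1 or 2 at every constant field) and one cell marked «TRUE for
curves, NOT in the tree under any name»: (T4) = (s2) of Cruxes/PrimeFieldToPerfect/Disproof.lean §4 = strategist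
census N3 — take `π` FINITE («normalise the twist, never blow up»). res-L1-s82-pv-2 (gen 4) proved the negative half
(`TwistNormal.no_smooth_finite_model_twist`, p515046 ff.: the surface `x^p − t = yz`, false at `n = 2` at every
level `≥ 1`). THIS FILE proves the positive half, for EVERY field `K` of characteristic `p`:

* §1 (topology) `finite_of_isClosed_of_ne_univ_of_topologicalKrullDim_le_one` — a proper closed subset of an
  irreducible Noetherian `T₀` space of Krull dimension `≤ 1` is finite;
* §2 (schemes) `subsingleton_preimage_singleton_of_isIso_morphismRestrict` (fibres over the isomorphism locus),
  **`isFinite_of_isProper_of_isBirational_of_topologicalKrullDim_le_one`** — a proper birational morphism from an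
  irreducible Noetherian scheme of dimension `≤ 1` is FINITE (its fibres are finite: one point over the
  isomorphism locus, inside the finite complement of the dense open `π⁻¹U` elsewhere; then Zariski's Main Theorem,
  Mathlib `IsFinite.of_isProper_of_locallyQuasiFinite`), and the integral form
  `isFinite_of_isProper_of_isBirational_of_dim_le_one` (dimension hypothesis on the TARGET, via the tree's
  `IsBirational.topologicalKrullDim_le`);
* §3 (twists) `isIntegral_frobeniusTwist` — every Frobenius twist `X₀ ×_{K,Frob^e} K` of an `X₀` that is
  `IntegralOverPerfectClosure` is integral; `topologicalKrullDim_frobeniusTwist` — twists keep the dimension;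
* §4 (the cell) **`isFinite_of_smooth_model_of_twist_of_dim_le_one`** — for a CURVE `X₀` (separatedness not
  needed: finite type, dimension `≤ 1`, `IntegralOverPerfectClosure`), EVERY proper birational model of EVERY
  Frobenius twist that is smooth over `K` is finite over the twist (so it is the normalisation of the twist);
  **`exists_finite_smooth_model_twist_of_dim_le_one`** — hence SOME twist of every separated such curve has a
  FINITE birational model smooth over `K` (the body of the typer's unfiled `HasSmoothFiniteTwistModel p K f₀`,
  binder for binder), at every exponent beyond the first admissible one (`…_eventually`); and the graded shapes
  **`finiteTwistStep_of_le_one`** / `finiteTwistStepRegular_of_le_one` — for every field `M` of characteristic `p`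
  and every grade `n ≤ 1`, the bodies of `FrobeniusTwistStepFiniteAt p M n` / `FrobeniusTwistStepFiniteRegularAt p M n`
  (L/res-L1-type-o6/drafts/PRIVATE-UniversalCellsCampaignW82TwistFiniteModel.draft.lean) hold, unconditionally.

READING FOR THE SLOT. With pv-2's rung the T4 row is now kernel-complete: the finite («normalise only») mechanism
proves the residual EXACTLY in dimension `≤ 1` and at no higher grade. Nothing here touches the open grades `n ≥ 4`.

HONEST FRAMING. OURS campaign theorems about OURS statements (role replaced: §17 ¶2 p.89 l.59–62 of [Hironaka2017],
typed AS PRINTED as `S17Methodology.U89_3`); NOT statements of the manuscript; nothing attributed to its author; no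
typed candidate used, not even as a hypothesis. AI work, weaker than expert review; no claim beyond the kernel.

## References (locators; nothing cited as a premise)
* The Stacks Project, Tags 02LS (finite = proper + locally quasi-finite), 01RN (birational), 0ECG. [StacksProject]
* J. Kollár, *Lectures on Resolution of Singularities* (2007), 1.19 (curves over non-perfect fields: the twist
  `y² = (x − t^{1/p})^p` normalises to a line). [Kollar2007]
* Cruxes/PrimeFieldToPerfect/Disproof.lean §4 (s2); STRATEGY-CENSUS.md N3; W82-TYPED-MAP.md §11 — cell files, OURS.
-/

noncomputable section

set_option linter.dupNamespace false -- mandated namespace of this single-conjunct summit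

open _root_.CategoryTheory _root_.CategoryTheory.Limits _root_.AlgebraicGeometry _root_.TopologicalSpace
open _root_.Topology
open Literature.AlgebraicGeometry.Resolution

namespace Summit.ResolutionOfSingularities.ResolutionOfSingularities.Theorems.CampaignW82

universe u

/-! ## §1 Proper closed subsets of an irreducible Noetherian space of dimension `≤ 1` are finite -/

/-- **A proper closed subset of an irreducible Noetherian `T₀` space of Krull dimension `≤ 1` is finite.** Each
of its finitely many irreducible components `t` lies strictly below `univ` in `IrreducibleCloseds Z`, so by
`Order.krullDim_le_one_iff` it is minimal there; hence every point of `t` is generic in `t`, and `T₀` makes `t` a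
single point. [folklore] -/
theorem finite_of_isClosed_of_ne_univ_of_topologicalKrullDim_le_one {Z : Type*} [TopologicalSpace Z]
    [NoetherianSpace Z] [T0Space Z] [IrreducibleSpace Z] (hZ : topologicalKrullDim Z ≤ 1) {F : Set Z}
    (hF : IsClosed F) (hFu : F ≠ Set.univ) : F.Finite := by
  obtain ⟨S, hSf, hSc, hSi, rfl⟩ := NoetherianSpace.exists_finite_set_isClosed_irreducible hF
  refine hSf.sUnion fun t ht => ?_
  have htu : t ≠ Set.univ := by
    rintro rfl
    exact hFu (Set.eq_univ_of_univ_subset (Set.subset_sUnion_of_mem ht))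
  -- `t < univ` in `IrreducibleCloseds Z`, so `t` is minimal (dimension `≤ 1`)
  let T : IrreducibleCloseds Z := ⟨t, hSi t ht, hSc t ht⟩
  let Z₁ : IrreducibleCloseds Z := ⟨Set.univ, IrreducibleSpace.isIrreducible_univ Z, isClosed_univ⟩
  have hlt : T < Z₁ := lt_of_le_of_ne (fun x _ => Set.mem_univ x) fun h =>
    htu (congrArg (fun C : IrreducibleCloseds Z => (C : Set Z)) h)
  have hmin : IsMin T := ((Order.krullDim_le_one_iff.mp hZ) T).resolve_right hlt.not_isMax
  -- every point of `t` is generic in `t`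
  have key : ∀ z ∈ t, t ⊆ closure {z} := fun z hz => by
    have hle : (⟨closure {z}, isIrreducible_singleton.closure, isClosed_closure⟩ : IrreducibleCloseds Z) ≤ T :=
      fun w hw => (closure_minimal (Set.singleton_subset_iff.mpr hz) (hSc t ht) : closure {z} ⊆ t) hw
    intro w hw
    exact (hmin hle : T ≤ _) hw
  refine Set.Subsingleton.finite fun x hx y hy => ?_
  have hxy : y ⤳ x := specializes_iff_mem_closure.mpr (key y hy hx)
  have hyx : x ⤳ y := specializes_iff_mem_closure.mpr (key x hx hy)
  exact (hyx.antisymm hxy).eq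

/-! ## §2 A proper birational morphism from (or onto) a curve is finite -/

/-- Over the open `U ⊆ X` on which `π : Y ⟶ X` restricts to an isomorphism, the fibres of `π` are subsingletons
(`π ∣_ U` is injective on points). [folklore] -/
theorem subsingleton_preimage_singleton_of_isIso_morphismRestrict {Y X : Scheme.{u}} (π : Y ⟶ X) (U : X.Opens)
    [IsIso (π ∣_ U)] {x : X} (hx : x ∈ U) : (π ⁻¹' {x} : Set Y).Subsingleton := by
  intro y₁ h₁ y₂ h₂
  have h₁' : π y₁ = x := h₁
  have h₂' : π y₂ = x := h₂
  have hy₁ : y₁ ∈ π ⁻¹ᵁ U := show π y₁ ∈ U by rw [h₁']; exact hx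
  have hy₂ : y₂ ∈ π ⁻¹ᵁ U := show π y₂ ∈ U by rw [h₂']; exact hx
  have hinj := (π ∣_ U).isOpenEmbedding.injective
  have heq : (⟨y₁, hy₁⟩ : ↥(π ⁻¹ᵁ U)) = ⟨y₂, hy₂⟩ := hinj (Subtype.ext (by
    rw [morphismRestrict_base_coe, morphismRestrict_base_coe]
    exact h₁'.trans h₂'.symm))
  exact congrArg Subtype.val heq

/-- **A proper birational morphism from an irreducible Noetherian scheme of dimension `≤ 1` is finite.** Its
fibres are finite — over the dense open `U` of the birationality datum they are subsingletons
(`subsingleton_preimage_singleton_of_isIso_morphismRestrict`), elsewhere they lie in the complement of the dense,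
hence non-empty, open `π⁻¹U`, a proper closed subset of `Y`, which is finite
(`finite_of_isClosed_of_ne_univ_of_topologicalKrullDim_le_one`) — so `π` is locally quasi-finite (Mathlib
`LocallyQuasiFinite.of_finite_preimage_singleton`), and proper + locally quasi-finite is finite (Zariski's Main
Theorem, Mathlib `IsFinite.of_isProper_of_locallyQuasiFinite`). [cite: StacksProject, Tag 02LS] -/
theorem isFinite_of_isProper_of_isBirational_of_topologicalKrullDim_le_one {Y X : Scheme.{u}} (π : Y ⟶ X)
    [IsProper π] (hB : IsBirational π) [IrreducibleSpace Y] [NoetherianSpace Y]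
    (hY : topologicalKrullDim Y ≤ 1) : IsFinite π := by
  obtain ⟨U, -, hUd', hiso⟩ := hB
  haveI := hiso
  haveI : LocallyQuasiFinite π := by
    refine LocallyQuasiFinite.of_finite_preimage_singleton π fun x => ?_
    by_cases hx : x ∈ U
    · exact (subsingleton_preimage_singleton_of_isIso_morphismRestrict π U hx).finite
    · have hsub : (π ⁻¹' {x} : Set Y) ⊆ (((π ⁻¹ᵁ U : Y.Opens) : Set Y))ᶜ := by
        intro y hy hyU
        have hyx : π y = x := hy
        exact hx (hyx ▸ hyU)
      refine (finite_of_isClosed_of_ne_univ_of_topologicalKrullDim_le_one hY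
        (π ⁻¹ᵁ U).isOpen.isClosed_compl ?_).subset hsub
      intro h
      obtain ⟨y, hy⟩ := hUd'.nonempty
      have hy' : y ∈ (((π ⁻¹ᵁ U : Y.Opens) : Set Y))ᶜ := h ▸ Set.mem_univ y
      exact hy' hy
  exact IsFinite.of_isProper_of_locallyQuasiFinite π

/-- **A proper birational morphism of integral schemes onto a Noetherian scheme of dimension `≤ 1` is finite**
(the source then has dimension `≤ 1` by the tree's `IsBirational.topologicalKrullDim_le`, and is Noetherian).
For a REGULAR target it is even an isomorphism (`isIso_of_isBirational_of_isRegular_of_topologicalKrullDim_le_one`,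
gen 3); in general it is the normalisation when the source is normal. [cite: StacksProject, Tag 02LS] -/
theorem isFinite_of_isProper_of_isBirational_of_dim_le_one {Y X : Scheme.{u}} [IsIntegral Y] [IsIntegral X]
    [IsNoetherian X] (π : Y ⟶ X) [IsProper π] (hB : IsBirational π) (hX : topologicalKrullDim X ≤ 1) :
    IsFinite π := by
  haveI : IsLocallyNoetherian Y := LocallyOfFiniteType.isLocallyNoetherian π
  haveI : CompactSpace Y := QuasiCompact.compactSpace_of_compactSpace π
  haveI : IsNoetherian Y := {}
  exact isFinite_of_isProper_of_isBirational_of_topologicalKrullDim_le_one π hB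
    (hB.topologicalKrullDim_le.trans hX)

/-! ## §3 Frobenius twists of an `X₀` integral over the perfect closure -/

/-- **Every Frobenius twist `X₀ ×_{K,Frob^e} Spec K` of an `X₀` integral over the perfect closure is integral**:
`Frob^e : K → K` makes `K` a purely inseparable extension of itself (`x^{p^e}` lies in the image), and
`IntegralOverPerfectClosure` gives integrality over EVERY purely inseparable extension
(`IntegralOverPerfectClosure.isIntegral_pullback`). [folklore] -/
theorem isIntegral_frobeniusTwist (p : ℕ) [Fact p.Prime] {K : Type} [Field K] [CharP K p] {X₀ : Scheme.{0}}
    {f₀ : X₀ ⟶ Spec (.of K)} [LocallyOfFiniteType f₀] (h : IntegralOverPerfectClosure K f₀) (e : ℕ) :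
    IsIntegral (pullback f₀ (Spec.map (CommRingCat.ofHom (iterateFrobenius K p e)))) := by
  letI alg : Algebra K K := (iterateFrobenius K p e).toAlgebra
  haveI : ExpChar K p := ExpChar.prime (Fact.out : p.Prime)
  haveI hpi : @IsPurelyInseparable K K _ _ alg := by
    refine (@isPurelyInseparable_iff_pow_mem K K _ _ _ alg p _).2 fun x => ⟨e, ?_⟩
    exact RingHom.mem_range.mpr ⟨x, iterateFrobenius_def p e x⟩
  exact @IntegralOverPerfectClosure.isIntegral_pullback K _ X₀ f₀ _ h K _ alg hpi

/-- **Frobenius twists keep the dimension** (base change along a map of fields,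
`Motives.topologicalKrullDim_eq_of_isPullback`). [folklore] -/
theorem topologicalKrullDim_frobeniusTwist (p : ℕ) {K : Type} [Field K] [ExpChar K p] {X₀ : Scheme.{0}}
    (f₀ : X₀ ⟶ Spec (.of K)) [LocallyOfFiniteType f₀] (e : ℕ) :
    topologicalKrullDim ↥(pullback f₀ (Spec.map (CommRingCat.ofHom (iterateFrobenius K p e)))) =
      topologicalKrullDim X₀ :=
  Literature.AlgebraicGeometry.Motives.topologicalKrullDim_eq_of_isPullback (iterateFrobenius K p e) f₀
    (pullback.fst f₀ _) (pullback.snd f₀ _) (IsPullback.of_hasPullback f₀ _)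

/-! ## §4 The cell T4⁺: for curves, every smooth proper birational model of a twist is finite, and one exists -/

/-- **For a CURVE, every smooth proper birational model of every Frobenius twist is FINITE over the twist.** Let
`K` have characteristic `p`, `f₀ : X₀ ⟶ Spec K` be of finite type with `topologicalKrullDim X₀ ≤ 1` and
`IntegralOverPerfectClosure K f₀`, and let `π : Y ⟶ X₀^{(p^e)}` be proper birational with `Y ⟶ Spec K` smooth.
Then `π` is finite: the twist is integral (`isIntegral_frobeniusTwist`), Noetherian, of dimension `≤ 1`
(`topologicalKrullDim_frobeniusTwist`); `Y` is reduced (smooth over a field) hence integral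
(`IsBirational.isIntegral`); apply `isFinite_of_isProper_of_isBirational_of_dim_le_one`. Since `Y` is normal and
`π` finite birational, `Y` is the normalisation of the twist — «for curves, the residual's model is the normalised
twist». [folklore] -/
theorem isFinite_of_smooth_model_of_twist_of_dim_le_one (p : ℕ) [Fact p.Prime] (K : Type) [Field K] [CharP K p]
    {X₀ : Scheme.{0}} (f₀ : X₀ ⟶ Spec (.of K)) [LocallyOfFiniteType f₀] [QuasiCompact f₀]
    (hd : topologicalKrullDim X₀ ≤ 1) (hint : IntegralOverPerfectClosure K f₀) (e : ℕ) (Y : Scheme.{0})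
    (π : Y ⟶ pullback f₀ (Spec.map (CommRingCat.ofHom (iterateFrobenius K p e)))) [IsProper π]
    (hB : IsBirational π)
    [Smooth (π ≫ pullback.snd f₀ (Spec.map (CommRingCat.ofHom (iterateFrobenius K p e))))] : IsFinite π := by
  haveI := isIntegral_frobeniusTwist p hint e
  haveI : AlgebraicGeometry.IsNoetherian (pullback f₀ (Spec.map (CommRingCat.ofHom (iterateFrobenius K p e)))) :=
    Scheme.isNoetherian_of_finiteType_over_field
      (pullback.snd f₀ (Spec.map (CommRingCat.ofHom (iterateFrobenius K p e))))
  haveI : IsReduced Y :=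
    isReduced_of_smooth (π ≫ pullback.snd f₀ (Spec.map (CommRingCat.ofHom (iterateFrobenius K p e))))
  haveI : IsIntegral Y := hB.isIntegral
  have hdT : topologicalKrullDim ↥(pullback f₀ (Spec.map (CommRingCat.ofHom (iterateFrobenius K p e)))) ≤ 1 := by
    rw [topologicalKrullDim_frobeniusTwist p f₀ e]
    exact hd
  exact isFinite_of_isProper_of_isBirational_of_dim_le_one π hB hdT

/-- **T4⁺: SOME Frobenius twist of every curve has a FINITE birational model smooth over `K`** — for every field
`K` of characteristic `p` and every separated `f₀ : X₀ ⟶ Spec K` of finite type with `topologicalKrullDim X₀ ≤ 1` and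
`IntegralOverPerfectClosure K f₀` (irreducible, geometrically reduced). This is, binder for binder, the body of the
typer's (unfiled) predicate `HasSmoothFiniteTwistModel p K f₀` = strengthening (s2) of
Cruxes/PrimeFieldToPerfect/Disproof.lean §4 = census N3 «the normalisation of `X₀ ⊗ K^{1/p^m}` is smooth for
`m ≫ 0` — true for curves»; the unconditional rung `hasSmoothFrobeniusTwistModel_of_dim_le_one` (gen 2) supplies a
PROPER smooth model, which `isFinite_of_smooth_model_of_twist_of_dim_le_one` shows to be finite. FALSE from
dimension `2` (res-L1-s82-pv-2, `TwistNormal.no_smooth_finite_model_twist`: the surface `x^p − t = yz`).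
[folklore] -/
theorem exists_finite_smooth_model_twist_of_dim_le_one (p : ℕ) [Fact p.Prime] (K : Type) [Field K] [CharP K p]
    {X₀ : Scheme.{0}} (f₀ : X₀ ⟶ Spec (.of K)) [IsSeparated f₀] [LocallyOfFiniteType f₀] [QuasiCompact f₀]
    (hd : topologicalKrullDim X₀ ≤ 1) (hint : IntegralOverPerfectClosure K f₀) :
    ∃ (e : ℕ) (Y : Scheme.{0})
      (π : Y ⟶ pullback f₀ (Spec.map (CommRingCat.ofHom (iterateFrobenius K p e)))),
      IsFinite π ∧ IsBirational π ∧
        Smooth (π ≫ pullback.snd f₀ (Spec.map (CommRingCat.ofHom (iterateFrobenius K p e)))) := by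
  obtain ⟨e, Y, π, hP, hB, hS⟩ := hasSmoothFrobeniusTwistModel_of_dim_le_one p K f₀ hd hint
  haveI := hP
  haveI := hS
  exact ⟨e, Y, π, isFinite_of_smooth_model_of_twist_of_dim_le_one p K f₀ hd hint e Y π hB, hB, hS⟩

/-- **Every sufficiently large exponent carries a finite smooth model** (curves): there is `e₀` such that for
every `e ≥ e₀` the twist `X₀^{(p^e)}` has a finite birational model smooth over `K` (the proper models exist
eventually, `HasSmoothFrobeniusTwistModel.eventually`, and are finite by
`isFinite_of_smooth_model_of_twist_of_dim_le_one`). [folklore] -/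
theorem exists_finite_smooth_model_twist_eventually (p : ℕ) [Fact p.Prime] (K : Type) [Field K] [CharP K p]
    {X₀ : Scheme.{0}} (f₀ : X₀ ⟶ Spec (.of K)) [IsSeparated f₀] [LocallyOfFiniteType f₀] [QuasiCompact f₀]
    (hd : topologicalKrullDim X₀ ≤ 1) (hint : IntegralOverPerfectClosure K f₀) :
    ∃ e₀ : ℕ, ∀ e : ℕ, e₀ ≤ e → ∃ (Y : Scheme.{0})
      (π : Y ⟶ pullback f₀ (Spec.map (CommRingCat.ofHom (iterateFrobenius K p e)))),
      IsFinite π ∧ IsBirational π ∧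
        Smooth (π ≫ pullback.snd f₀ (Spec.map (CommRingCat.ofHom (iterateFrobenius K p e)))) := by
  obtain ⟨e₀, he₀⟩ := HasSmoothFrobeniusTwistModel.eventually p K f₀
    (hasSmoothFrobeniusTwistModel_of_dim_le_one p K f₀ hd hint)
  refine ⟨e₀, fun e he => ?_⟩
  obtain ⟨Y, π, hP, hB, hS⟩ := he₀ e he
  haveI := hP
  haveI := hS
  exact ⟨Y, π, isFinite_of_smooth_model_of_twist_of_dim_le_one p K f₀ hd hint e Y π hB, hB, hS⟩

/-- **The finite-modification step holds at every grade `n ≤ 1`, for EVERY field `M` of characteristic `p`,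
unconditionally** — binder for binder the body of the typer's (unfiled) `FrobeniusTwistStepFiniteAt p M n`: the
hypothesis block of `PerfectionStepAt M n` (not used) ⇒ every separated `X₀` of finite type over `RatFunc M` of
dimension `≤ n`, integral over the perfect closure, has a FINITE smooth model of some Frobenius twist. With
res-L1-s82-pv-2's `TwistNormal.no_smooth_finite_model_twist` (false at `n = 2`, every `M`), the finite mechanism
proves the residual of slot W8.2 exactly in dimension `≤ 1`. [folklore] -/
theorem finiteTwistStep_of_le_one (p : ℕ) [Fact p.Prime] (M : Type) [Field M] [CharP M p] {n : WithBot ℕ∞}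
    (hn : n ≤ 1) :
    (∀ (X : Scheme.{0}) (f : X ⟶ Spec (.of (RatFunc M))),
        IsSeparated f → LocallyOfFiniteType f → QuasiCompact f → IsIntegral X →
          topologicalKrullDim X ≤ n → Scheme.HasResolution X) →
      ∀ (X₀ : Scheme.{0}) (f₀ : X₀ ⟶ Spec (.of (RatFunc M))),
        IsSeparated f₀ → LocallyOfFiniteType f₀ → QuasiCompact f₀ → topologicalKrullDim X₀ ≤ n →
          IntegralOverPerfectClosure (RatFunc M) f₀ →
            ∃ (e : ℕ) (Y : Scheme.{0})
              (π : Y ⟶ pullback f₀ (Spec.map (CommRingCat.ofHom (iterateFrobenius (RatFunc M) p e)))),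
              IsFinite π ∧ IsBirational π ∧
                Smooth (π ≫ pullback.snd f₀
                  (Spec.map (CommRingCat.ofHom (iterateFrobenius (RatFunc M) p e)))) := by
  intro _ X₀ f₀ hs hl hq hd hint
  haveI := hs
  haveI := hl
  haveI := hq
  exact exists_finite_smooth_model_twist_of_dim_le_one p (RatFunc M) f₀ (hd.trans hn) hint

/-- The same for REGULAR `X₀` — binder for binder the body of the typer's (unfiled)
`FrobeniusTwistStepFiniteRegularAt p M n`, every `M` of characteristic `p`, every `n ≤ 1` (the regularity
hypothesis is simply dropped). [folklore] -/
theorem finiteTwistStepRegular_of_le_one (p : ℕ) [Fact p.Prime] (M : Type) [Field M] [CharP M p]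
    {n : WithBot ℕ∞} (hn : n ≤ 1) :
    (∀ (X : Scheme.{0}) (f : X ⟶ Spec (.of (RatFunc M))),
        IsSeparated f → LocallyOfFiniteType f → QuasiCompact f → IsIntegral X →
          topologicalKrullDim X ≤ n → Scheme.HasResolution X) →
      ∀ (X₀ : Scheme.{0}) (f₀ : X₀ ⟶ Spec (.of (RatFunc M))),
        IsSeparated f₀ → LocallyOfFiniteType f₀ → QuasiCompact f₀ → topologicalKrullDim X₀ ≤ n →
          IntegralOverPerfectClosure (RatFunc M) f₀ → Scheme.IsRegular X₀ →
            ∃ (e : ℕ) (Y : Scheme.{0})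
              (π : Y ⟶ pullback f₀ (Spec.map (CommRingCat.ofHom (iterateFrobenius (RatFunc M) p e)))),
              IsFinite π ∧ IsBirational π ∧
                Smooth (π ≫ pullback.snd f₀
                  (Spec.map (CommRingCat.ofHom (iterateFrobenius (RatFunc M) p e)))) :=
  fun hM X₀ f₀ hs hl hq hd hint _ => finiteTwistStep_of_le_one p M hn hM X₀ f₀ hs hl hq hd hint

end Summit.ResolutionOfSingularities.ResolutionOfSingularities.Theorems.CampaignW82

end
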